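import Literature.MathematicalPhysics.QuantumLattice.HubbardModel
import Literature.MathematicalPhysics.QuantumLattice.HubbardRectangularTorus
import Literature.MathematicalPhysics.QuantumLattice.HubbardWave0LiebProofs
import HarnessLib

/-!
# The `t–t'` Hubbard model: next-nearest-neighbour (diagonal) hopping on square and rectangular tori

Topic `MathematicalPhysics/QuantumLattice` (family `hubbard`). The square-lattice Hubbard model
with nearest-neighbour hopping `t`, next-nearest-neighbour (diagonal) hopping `t'` and on-site
repulsion `U`,

  `H = -t Σ_{⟨ij⟩,σ} c†_{iσ} c_{jσ} - t' Σ_{⟨⟨ij⟩⟩,σ} c†_{iσ} c_{jσ} + U Σ_i n_{i↑} n_{i↓}`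

(both hopping sums over ORDERED pairs, i.e. including the Hermitian conjugates), as printed in
Xu, Chung, Qin, Schollwöck, White, Zhang, *Science* 384 (2024) eadh7691, eq. (1) (there with a
chemical-potential term `-μ Σ n`, dropped here: we work in fixed particle-number sectors) and in
LeBlanc et al. (Simons Collaboration), *PRX* 5 (2015) 041041, eq. (1) (`t_{ij} ∈ {t, t'}`).
Hole-doped cuprate parametrisations have `t'/t < 0` (Xu et al.: `t'/t = -0.2`).

## Design

The tree's generic `hamiltonian G t U` (hopping `-t` along the simple graph `G`, interaction `U`)
is reused summand-wise: `H(t, t', U) = hamiltonian G_nn t U + hamiltonian G_diag t' 0`, where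
`G_diag` is the DIAGONAL graph (`x ∼ x ± e₁ ± e₂`). Hence hermiticity and `N`/`S^z` conservation are
inherited from `hamiltonian_isHermitian_and_commute_holds`, and at `t' = 0` the model is literally
the tree's `hubbardTorus` / rectangular Hubbard Hamiltonian. Two vertex types are provided, exactly
as for the nearest-neighbour model: the square torus `FermionTorus 2 L` (sites `TorusSite 2 L =
Fin 2 → ZMod L` pulled back along `FermionTorus.toTorusSite`) and the rectangular torus
`Fin a ×ₗ Fin b` of `HubbardRectangularTorus.lean` (ring adjacency of representatives, `ringAdj`).
Degenerate sides: for a side of length `2` the two diagonal offsets `e₁ + e₂`, `e₁ - e₂` coincide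
and give ONE bond of the simple graph (e.g. `4 × 2`: 8 diagonal bonds; `2 × 2`: 2); for a side of
length `1` there is no diagonal bond. Bulk-like clusters have all sides `≥ 3` (`4 × 4`: 32 bonds,
`6 × 6`: 72).

## Not here

The thermodynamic limit of the `t–t'` ground-state energy density (the Fekete/cut machinery of
`HubbardModelThermodynamicLimit*.lean` is written for ONE graph family and has to be re-run for the
two-graph Hamiltonian), band structure, and every physical claim about the model.
-/

noncomputable section

namespace Literature.MathematicalPhysics.QuantumLattice

open Matrix Literature.Probability.LatticeModels

/-! ### Square torus `(ℤ/Lℤ)²` -/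

/-- The two diagonal jump vectors of `(ℤ/Lℤ)²`: `e₁ + e₂` (`s = 0`) and `e₁ - e₂` (`s = 1`).
[folklore] -/
def torusDiagJump (L : ℕ) (s : Fin 2) : TorusSite 2 L :=
  fun i => if i = 0 then 1 else if s = 0 then 1 else -1

/-- The next-nearest-neighbour (diagonal) graph on the discrete torus `(ℤ/Lℤ)²`: `x ∼ y` iff
`x ≠ y` and `y = x ± (e₁ + e₂)` or `y = x ± (e₁ - e₂)` (a simple graph: coinciding offsets for
`L ≤ 2` give one edge). [folklore] -/
def torusDiagGraph (L : ℕ) : SimpleGraph (TorusSite 2 L) :=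
  SimpleGraph.fromRel fun x y => ∃ s : Fin 2, y = x + torusDiagJump L s

/-- Diagonal adjacency on `(ℤ/Lℤ)²` is decidable. [folklore] -/
instance instDecidableRelTorusDiagGraphAdj (L : ℕ) : DecidableRel (torusDiagGraph L).Adj :=
  fun _ _ => inferInstanceAs (Decidable (_ ∧ _))

/-- The diagonal graph pulled back to the fermionic torus `FermionTorus 2 L` along
`FermionTorus.toTorusSite` (as `fermionTorusGraph` is the pull-back of `torusGraph`). [folklore] -/
def fermionTorusDiagGraph (L : ℕ) : SimpleGraph (FermionTorus 2 L) :=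
  (torusDiagGraph L).comap FermionTorus.toTorusSite

/-- Diagonal adjacency on the fermionic torus is decidable. [folklore] -/
instance instDecidableRelFermionTorusDiagGraphAdj (L : ℕ) :
    DecidableRel (fermionTorusDiagGraph L).Adj :=
  fun x y => instDecidableRelTorusDiagGraphAdj L (FermionTorus.toTorusSite x) (FermionTorus.toTorusSite y)

/-- The **`t–t'` Hubbard Hamiltonian on the square torus** `(ℤ/Lℤ)²`:
`H = -t Σ_{⟨xy⟩,σ} c†_{xσ}c_{yσ} - t' Σ_{⟨⟨xy⟩⟩,σ} c†_{xσ}c_{yσ} + U Σ_x n_{x↑}n_{x↓}` (ordered pairs),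
realised as `hamiltonian (n.n. graph) t U + hamiltonian (diagonal graph) t' 0`.
Xu et al., Science 384 (2024) eadh7691, eq. (1) (without the `-μ Σ n` term).
[cite: XuEtAl2024, eq. (1)] -/
def hubbardTorusTT' (L : ℕ) (t t' U : ℝ) :
    Matrix (Finset (Orb (FermionTorus 2 L))) (Finset (Orb (FermionTorus 2 L))) ℂ :=
  hamiltonian (fermionTorusGraph 2 L) t U + hamiltonian (fermionTorusDiagGraph L) t' 0

/-- At `t' = 0` the `t–t'` Hamiltonian is the tree's pure Hubbard torus Hamiltonian
`hubbardTorus 2 L t U`. [folklore] -/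
@[simp] theorem hubbardTorusTT'_zero (L : ℕ) (t U : ℝ) :
    hubbardTorusTT' L t 0 U = hubbardTorus 2 L t U := by
  simp [hubbardTorusTT', hubbardTorus, hamiltonian]

/-- The `t–t'` Hamiltonian is Hermitian. [folklore] -/
theorem hubbardTorusTT'_isHermitian (L : ℕ) (t t' U : ℝ) :
    (hubbardTorusTT' L t t' U).IsHermitian :=
  ((hamiltonian_isHermitian_and_commute_holds (fermionTorusGraph 2 L) t U).1).add
    ((hamiltonian_isHermitian_and_commute_holds (fermionTorusDiagGraph L) t' 0).1)

/-- The `t–t'` Hamiltonian conserves the particle number. [folklore] -/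
theorem hubbardTorusTT'_commute_totalNumber (L : ℕ) (t t' U : ℝ) :
    Commute (hubbardTorusTT' L t t' U) totalNumber :=
  ((hamiltonian_isHermitian_and_commute_holds (fermionTorusGraph 2 L) t U).2.1).add_left
    ((hamiltonian_isHermitian_and_commute_holds (fermionTorusDiagGraph L) t' 0).2.1)

/-- The `t–t'` Hamiltonian conserves `S^z`. [folklore] -/
theorem hubbardTorusTT'_commute_spinZ (L : ℕ) (t t' U : ℝ) :
    Commute (hubbardTorusTT' L t t' U) HubbardWave0.spinZ :=
  ((hamiltonian_isHermitian_and_commute_holds (fermionTorusGraph 2 L) t U).2.2).add_left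
    ((hamiltonian_isHermitian_and_commute_holds (fermionTorusDiagGraph L) t' 0).2.2)

/-! ### Rectangular torus `ℤ/aℤ × ℤ/bℤ` (lexicographically ordered sites, as `fermionRectTorusGraph`) -/

/-- The diagonal graph of the rectangular fermionic torus `ℤ/aℤ × ℤ/bℤ`: `(x, y) ∼ (x', y')` iff
`x, x'` are ring-neighbours in `ℤ/aℤ` AND `y, y'` are ring-neighbours in `ℤ/bℤ` (representatives,
`ringAdj`). For `a, b ≥ 3` these are the four offsets `(±1, ±1)`; a side of length `2` merges
`±1`, a side of length `1` has no ring-neighbours. [folklore] -/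
def fermionRectTorusDiagGraph (a b : ℕ) : SimpleGraph (Fin a ×ₗ Fin b) where
  Adj p q := ringAdj a (ofLex p).1 (ofLex q).1 ∧ ringAdj b (ofLex p).2 (ofLex q).2
  symm := ⟨fun _ _ h => ⟨ringAdj_symm h.1, ringAdj_symm h.2⟩⟩
  loopless := ⟨fun _ h => ringAdj_irrefl _ _ h.1⟩

/-- Diagonal adjacency on the rectangular fermionic torus is decidable. [folklore] -/
instance instDecidableRelFermionRectTorusDiagGraphAdj (a b : ℕ) :
    DecidableRel (fermionRectTorusDiagGraph a b).Adj := fun p q =>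
  inferInstanceAs (Decidable (ringAdj a (ofLex p).1 (ofLex q).1 ∧ ringAdj b (ofLex p).2 (ofLex q).2))

/-- Adjacency on the rectangular diagonal graph, unfolded. [folklore] -/
theorem fermionRectTorusDiagGraph_adj_iff {a b : ℕ} (p q : Fin a ×ₗ Fin b) :
    (fermionRectTorusDiagGraph a b).Adj p q ↔
      ringAdj a (ofLex p).1 (ofLex q).1 ∧ ringAdj b (ofLex p).2 (ofLex q).2 := Iff.rfl

/-- The **`t–t'` Hubbard Hamiltonian on the rectangular torus** `ℤ/aℤ × ℤ/bℤ`
(`hamiltonian (fermionRectTorusGraph a b) t U + hamiltonian (fermionRectTorusDiagGraph a b) t' 0`).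
LeBlanc et al., PRX 5 (2015) 041041, eq. (1) with `t_{ij} ∈ {t, t'}`. [cite: LeBlancEtAl2015, eq. (1)] -/
def hubbardRectTorusTT' (a b : ℕ) (t t' U : ℝ) :
    Matrix (Finset (Orb (Fin a ×ₗ Fin b))) (Finset (Orb (Fin a ×ₗ Fin b))) ℂ :=
  hamiltonian (fermionRectTorusGraph a b) t U + hamiltonian (fermionRectTorusDiagGraph a b) t' 0

/-- At `t' = 0` the rectangular `t–t'` Hamiltonian is the rectangular Hubbard Hamiltonian.
[folklore] -/
@[simp] theorem hubbardRectTorusTT'_zero (a b : ℕ) (t U : ℝ) :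
    hubbardRectTorusTT' a b t 0 U = hamiltonian (fermionRectTorusGraph a b) t U := by
  simp [hubbardRectTorusTT', hamiltonian]

/-- The rectangular `t–t'` Hamiltonian is Hermitian. [folklore] -/
theorem hubbardRectTorusTT'_isHermitian (a b : ℕ) (t t' U : ℝ) :
    (hubbardRectTorusTT' a b t t' U).IsHermitian :=
  ((hamiltonian_isHermitian_and_commute_holds (fermionRectTorusGraph a b) t U).1).add
    ((hamiltonian_isHermitian_and_commute_holds (fermionRectTorusDiagGraph a b) t' 0).1)

/-- The rectangular `t–t'` Hamiltonian conserves the particle number. [folklore] -/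
theorem hubbardRectTorusTT'_commute_totalNumber (a b : ℕ) (t t' U : ℝ) :
    Commute (hubbardRectTorusTT' a b t t' U) totalNumber :=
  ((hamiltonian_isHermitian_and_commute_holds (fermionRectTorusGraph a b) t U).2.1).add_left
    ((hamiltonian_isHermitian_and_commute_holds (fermionRectTorusDiagGraph a b) t' 0).2.1)

end Literature.MathematicalPhysics.QuantumLattice

end
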